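import Literature.MathematicalPhysics.QuantumFieldTheory.Balaban1983to89.B6Cor28HolderEntryKLevelV1
import Literature.MathematicalPhysics.QuantumFieldTheory.Balaban1983to89.B6QGQCoerciveKLevelV1
import HarnessLib

/-!
# `Balaban1983to89.B6Cor28HolderKLevelV1` — T. Bałaban, *Propagators and renormalization transformations for lattice gauge theories. II*,
Comm. Math. Phys. **96** (1984) 223–250 [Balaban1984PropagatorsII], **Corollary 2.8, the HÖLDER entry of (2.151) p. 249 AT k LEVELS for the genuine
`H = GQ*(QGQ*)⁻¹ = GE ∘ QsE ∘ EE (domT hN D hk)` — its pair differences `(∇_νHe_c)(x) − (∇_νHe_c)(x′)` over the admissible pairs, HYPOTHESIS-FREE**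
(B6-CLOSURE §5 item 20, second file; owner r03), MODULO ONE DISPLAYED INPUT: `B6Cor28HolderEntryKLevelV1.cor28_kLevel_holder_of_2137_2147_len`
with the level-weighted (2.147) discharged BY NAME by ROUTE W part W1 `B6QGQCoerciveKLevelV1.qgq_coercive_kLevel` (`γ := γ₀ = gam0 d ℓ b₁`,
`hwup_of_globalBand`), and the (2.137)₁ majorant of `P_{x,x′}·∇_νG` (Prop. 2.6 (2.137)₁ at k levels for the genuine `G`, «M sufficiently large»
UNIFORM in the Hölder exponent) kept as the DISPLAYED hypothesis `h2137` in the exact shape p22's k-level (2.137)₁ programme produces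
(`B6Ineq2137GradKLevelV1.holderLegs_kLevel` + `B6Prop26HolderGradKLevelV1.prop26_2137_grad_kLevel_of_legs` ✓ p374136, quantifier order
`∃σ₁ ∀σ ∀β ∃M₂ ∀α ∃A`; the former is in flight in p22's lane) — the discharge `ineq2137_grad_kLevel_unif` and the hypothesis-free corollary follow in the
sequel `B6Cor28HolderUnifKLevelV1` once `B6Ineq2137GradKLevelV1` has landed (same pattern as the Prop. 2.6 census `B6Prop26Census2137KLevelV1`, slot hm1).

HONEST FRAMING (programme rule): statement-level skeleton of published theorems with citation tags; proofs where landed; nothing here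
is a claim about the Yang–Mills mass gap.

WHAT IS PRINTED (p. 249): «|H(b,c)|, |(∇H)(b,c)|, ‖(ζ∇H)(·,c)‖_α ≤ O(1)[1, (L^jη)^{−1}, (L^jη)^{−1−α}(‖ζ‖^ξ_α + |ζ|)](L^{j′}η)^{−d}e^{−δ₅d(y,c₋)}, (1.151)[sic]
b ∈ Δ(y) or supp ζ ⊂ Δ(y), y ∈ Λ_j, c₋ ∈ Λ_{j′}»; [4] (1.109) «‖A‖_α = max_μ sup_{x,x′: |x−x′| ≤ 1} |x − x′|^{−α}|A_μ(x) − A_μ(x′)|».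

## WHAT THIS FILE CERTIFIES (kernel-checked, sorry-free, standard axioms; THEOREMS ONLY)

* **`cor28_kLevel_holderPair_of_2137 (h2137 : …)`** = COROLLARY 2.8, THE HÖLDER ENTRY (2.151)₃ AT k LEVELS for the genuine `H`, PER ADMISSIBLE PAIR, MODULO the displayed
  (2.137)₁ input `h2137` (statement = the conclusion of the sequel's `ineq2137_grad_kLevel_unif`, verbatim):
  for every `σ ∈ (0, σ₁]` and rate parameter `α_r ∈ (0, 1)` there are `δ₅ > 0` and thresholds `M₂ > 0`, `N₁` — UNIFORM in the Hölder exponent, as the census `B6.Cor28Printed` demands — and for every Hölder exponent `0 ≤ α < 1` a `C ≥ 0` such that on every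
  V1 torus family (`k ≥ 2`, `M_h = L^a ≥ 8`, `R ≥ 2L²`, `P′ ≥ 5`, odd `L ≥ 5`, cubes placed, `M₂ ≤ L·M_h`, `N₁ + 1 ≤ R·L·M_h`, `c_f ≠ 0`, weights in the
  band (2.16)), for EVERY direction `ν`, admissible pair of fine bonds `x, x′` (same direction, `|x − x′|_∞ ≤ L^{j(y(x))}`, `≤ L^{j(y(x′))}`) and index
  bond `c`: `|(∇_νHe_c)(x) − (∇_νHe_c)(x′)| ≤ C·t^α·(L^{j(y(x))}η)^{−1}·e^{−δ₅·d_T(y(x), β c)}`, `t = |x − x′|_∞/L^{j(y(x))}`, `η = |c_f|⁻¹` — print's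
  `O(1)(L^jη)^{−1−α}|x − x′|_phys^α(L^{j′}η)^{−d}e^{−δ₅d(y,c₋)}` per flat entry (the (2.150) weight `(L^{j(c)}η)^d` of the flat entry cancelling `(L^{j′}η)^{−d}`).

## HONEST SCOPE

(1) One pair at a time, output at `y(x)`, admissibility = p22's symmetric pair condition (print's `x, x′ ∈ Δ̃(y)`, quotient at the scale `ξ = L^{−j}`);
the cut-off dressing `(‖ζ‖^ξ_α + |ζ|)` (product rule `B6HolderPairMemberV1.abs_cutoff_pair_le` with the second entry `B6Cor28EntriesKLevelV1.cor28_kLevel_H_DH`)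
and the census typing `B6.Cor28Printed (d+1)` on this family (the Hölder seminorm as a supremum over admissible pairs) are the LAST file of item 20.
(2) `d(y, c₋)` := p21's torus graph distance (2.46); flat `ℓ²` entries.  (3) `δ₅ = (15/32)·δ₄(σ, α_r, γ₀)`; `C` ours, on `d, L, b₀, b₁, σ, α_r, α` (print:
«O(1)» on `d, L, α`; «δ₅» on `d, L`).  (4) The expansion form of `H` is not re-derived.  NOT summit progress.  Unit `lit-balaban-r03` (gens 25–26), 2026-08-24
(gen 26c: the α-uniform (2.137)₁ input is a DISPLAYED hypothesis here; its discharge from p22's `holderLegs_kLevel` + `prop26_2137_grad_kLevel_of_legs`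
is the sequel `B6Cor28HolderUnifKLevelV1`; conclusion of `cor28_kLevel_holderPair_of_2137` = the gen-25/26 `cor28_kLevel_holderPair` verbatim).
-/

namespace Literature.MathematicalPhysics.QuantumFieldTheory.Balaban1983to89.B6Cor28HolderKLevelV1

open scoped InnerProductSpace
open LatticeFieldCalculus
open B6SectAOperatorsV1 (QE QsE BondIdx BondIdxSpace)
open B6SectAVectorModelV1 (GE EE)
open B6Ineq2133TwoScaleV1 (onFun)
open B6RandomWalk (HasMajorant delta3)
open B6MultiLevelBoxOperator (N0)
open B6MultiLevelTorusOperator (TDomains)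
open B6GlobalChartV1 (PV domT blkV1)
open B6Geom246MultiLevelBox (bset)
open B6Geom246MultiLevelTorus (geomT)
open B8Ineq192MultiLevelTorus (geomT_len)
open B6Ineq2142KLevelV1 (lvl β)
open B6GradLegKLevelV1 (DV)
open B6HolderPairMemberV1 (pairOp)
open B6Cor28KLevelV1 (two_le_RMh)
open B6Cor28HolderEntryKLevelV1 (cor28_kLevel_holder_of_2137_2147_len)
open B6QGQCoerciveKLevelV1 (gam0 gam0_pos qgq_coercive_kLevel hwup_of_globalBand)
open B6CubeWindowV1 (Placed GlobalBand)
open B6Cover236MultiLevelBlocks (cubes)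

noncomputable section

open Classical in
/-- **[B6] COROLLARY 2.8, THE HÖLDER ENTRY `‖(ζ∇H)(·,c)‖_α` OF (2.151) — ITS PAIR DIFFERENCES OVER THE ADMISSIBLE PAIRS — AT k LEVELS FOR THE GENUINE
`H = GQ*(QGQ*)⁻¹ = GE ∘ QsE ∘ EE`, MODULO THE DISPLAYED (2.137)₁ INPUT `h2137`** (p22's (2.137)₁ at k levels, threshold uniform in the Hölder
exponent, `β := α_r`; discharged in the sequel `B6Cor28HolderUnifKLevelV1`): `cor28_kLevel_holder_of_2137_2147_len` with (2.147) by
`B6QGQCoerciveKLevelV1.qgq_coercive_kLevel` (`γ := γ₀`); binders = those of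
`B6QGQCoerciveKLevelV1.prop27_kLevel_unconditional` (`M₂`, `N₁` enlarged) plus the pair (`x.dir = x′.dir`, `|x − x′|_∞ ≤ L^{j(y(x))}`, `≤ L^{j(y(x′))}`):
`|(∇_νHe_c)(x) − (∇_νHe_c)(x′)| ≤ C·(|x − x′|_∞/L^{j(y(x))})^α·(len(y(x))·|c_f|⁻¹)⁻¹·e^{−δ₅ d_T(y(x), β c)}`.
[cite: Balaban1984PropagatorsII, Cor. 2.8 (2.150)–(2.151) p.249, Prop. 2.6 (2.137) p.247, Prop. 2.7 (2.147)–(2.149) p.248–249, Lemma 2.1 (2.60)–(2.63) p.234] -/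
theorem cor28_kLevel_holderPair_of_2137 (d ℓ : ℕ) (hd : 1 ≤ d + 1) (hL : Odd (ℓ + 1) ∧ 1 < ℓ + 1) {b₀ b₁ : ℝ} (hb₀ : 0 < b₀) (hb₁ : b₀ ≤ b₁)
    (h2137 :
      ∃ σ₁ : ℝ, 0 < σ₁ ∧ ∀ (σ : ℝ), 0 < σ → σ ≤ σ₁ → ∀ (β : ℝ), 0 < β → β ≤ 1 → ∃ M₂ : ℝ, 0 < M₂ ∧ ∀ (α : ℝ), 0 ≤ α → α < 1 →
      ∃ A : ℝ, 0 ≤ A ∧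
      ∀ (m K : ℕ) {Mh k R : ℕ} {P' : Fin (d + 1) → ℕ}
        (hN : ∀ μ, N0 ℓ Mh k P' μ = (PV d ℓ m K hd hL).sitesPerDir 0) (D : TDomains d ℓ Mh k P' R) (hk : k ≤ m + K) (_ : 2 ≤ k)
        {a : ℕ} (_ : Mh = (ℓ + 1) ^ a) (_ : 8 ≤ Mh) (_ : 2 * (ℓ + 1) ^ 2 ≤ R) (_ : ∀ μ, 5 ≤ P' μ) (_ : 4 ≤ ℓ)
        (_ : ∀ c : ↥(cubes D.toDomains), Placed ℓ k P' c.1) (_ : M₂ ≤ ((ℓ : ℝ) + 1) * Mh)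
        {cf : ℝ} (hcf : cf ≠ 0) {w : BondIdx (domT hN D hk) → ℝ} (hw : ∀ i, 0 < w i) (_ : GlobalBand b₀ b₁ cf w)
        (ν : Fin (d + 1)) (x x' : PBond (PV d ℓ m K hd hL) 0), x.dir = x'.dir →
        supDist x.src x'.src ≤ (ℓ + 1) ^ (blkV1 hN D x).1.1 → supDist x.src x'.src ≤ (ℓ + 1) ^ (blkV1 hN D x').1.1 →
        HasMajorant (g := geomT D) (blkV1 hN D) (pairOp x x' * DV (P := PV d ℓ m K hd hL) ν cf * onFun (GE (domT hN D hk) hcf hw))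
            (fun y y' => A * ((((supDist x.src x'.src : ℕ) : ℝ) / (((ℓ + 1 : ℕ) : ℝ)) ^ (blkV1 hN D x).1.1) ^ α *
              ((geomT D).len y * |cf|⁻¹)) * Real.exp (-(delta3 β (2 * σ) * (geomT D).dist y y')))) :
    ∃ σ₁ : ℝ, 0 < σ₁ ∧ ∀ (σ : ℝ), 0 < σ → σ ≤ σ₁ → ∀ (αr : ℝ), 0 < αr → αr < 1 →
    ∃ (δ₅ M₂ : ℝ) (N₁ : ℕ), 0 < δ₅ ∧ 0 < M₂ ∧ ∀ (α : ℝ), 0 ≤ α → α < 1 → ∃ C : ℝ, 0 ≤ C ∧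
    ∀ (m K : ℕ) {Mh k R : ℕ} {P' : Fin (d + 1) → ℕ}
      (hN : ∀ μ, N0 ℓ Mh k P' μ = (PV d ℓ m K hd hL).sitesPerDir 0) (D : TDomains d ℓ Mh k P' R) (hk : k ≤ m + K) (_ : 2 ≤ k)
      {a : ℕ} (_ : Mh = (ℓ + 1) ^ a) (_ : 8 ≤ Mh) (_ : 2 * (ℓ + 1) ^ 2 ≤ R) (_ : ∀ μ, 5 ≤ P' μ) (_ : 4 ≤ ℓ)
      (_ : ∀ c : ↥(cubes D.toDomains), Placed ℓ k P' c.1) (_ : M₂ ≤ ((ℓ : ℝ) + 1) * Mh) (_ : N₁ + 1 ≤ R * ((ℓ + 1) * Mh))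
      {cf : ℝ} (hcf : cf ≠ 0) {w : BondIdx (domT hN D hk) → ℝ} (hw : ∀ i, 0 < w i) (_ : GlobalBand b₀ b₁ cf w)
      (ν : Fin (d + 1)) (x x' : PBond (PV d ℓ m K hd hL) 0), x.dir = x'.dir →
      supDist x.src x'.src ≤ (ℓ + 1) ^ (blkV1 hN D x).1.1 → supDist x.src x'.src ≤ (ℓ + 1) ^ (blkV1 hN D x').1.1 →
      ∀ c : BondIdx (domT hN D hk),
      |(DV (P := PV d ℓ m K hd hL) ν cf ∘ₗ onFun (GE (domT hN D hk) hcf hw ∘ₗ QsE (domT hN D hk) ∘ₗ EE (domT hN D hk) hcf hw)) (Pi.single c 1) x -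
        (DV (P := PV d ℓ m K hd hL) ν cf ∘ₗ onFun (GE (domT hN D hk) hcf hw ∘ₗ QsE (domT hN D hk) ∘ₗ EE (domT hN D hk) hcf hw)) (Pi.single c 1) x'| ≤
        C * ((((supDist x.src x'.src : ℕ) : ℝ) / (((ℓ + 1 : ℕ) : ℝ)) ^ (blkV1 hN D x).1.1) ^ α *
          ((geomT D).len (blkV1 hN D x) * |cf|⁻¹)⁻¹) * Real.exp (-(δ₅ * (geomT D).dist (blkV1 hN D x) (β hN D hk c))) := by
  obtain ⟨σa, hσa, hA⟩ := cor28_kLevel_holder_of_2137_2147_len d ℓ hd hL hb₀ hb₁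
  obtain ⟨σb, hσb, hB⟩ := h2137
  refine ⟨min σa σb, lt_min hσa hσb, fun σ hσ hσ1 αr hαr hαr1 => ?_⟩
  have hb₁0 : 0 ≤ b₁ := hb₀.le.trans hb₁
  obtain ⟨δ₅, C, M₂, N₁, hδ₅, hC, hM₂, hK⟩ := hA σ hσ (hσ1.trans (min_le_left _ _)) αr hαr hαr1 (gam0 d ℓ b₁) (gam0_pos d ℓ hb₁0)
  obtain ⟨M₂', hM₂', hB'⟩ := hB σ hσ (hσ1.trans (min_le_right _ _)) αr hαr hαr1.le
  clear hA hB
  refine ⟨δ₅, max M₂ M₂', N₁, hδ₅, lt_max_of_lt_left hM₂, fun α hα hα1 => ?_⟩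
  obtain ⟨A, hA0, hG⟩ := hB' α hα hα1
  refine ⟨C * A, mul_nonneg hC hA0, ?_⟩
  intro m K Mh k R P' hN D hk hk2 a hMha hM8 hR2 hP5 hℓ hpl hM hRM cf hcf w hw hwb ν x x' hdir hd1 hd2 c
  have hk1 : 1 ≤ k := le_trans one_le_two hk2
  -- (2.147) by ROUTE W part W1; the (2.137)₁ majorant of the pair is the displayed input `h2137`
  have h2147 := qgq_coercive_kLevel hN D hk hk1 hℓ (two_le_RMh hR2 hM8) hcf hb₁0 hw (hwup_of_globalBand hN D hk hcf hwb)
  have hT := hG m K hN D hk hk2 hMha hM8 hR2 hP5 hℓ hpl ((le_max_right _ _).trans hM) hcf hw hwb ν x x' hdir hd1 hd2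
  have ht0 : 0 ≤ ((((supDist x.src x'.src : ℕ) : ℝ) / (((ℓ + 1 : ℕ) : ℝ)) ^ (blkV1 hN D x).1.1) ^ α) :=
    Real.rpow_nonneg (div_nonneg (Nat.cast_nonneg _) (pow_nonneg (Nat.cast_nonneg _) _)) _
  have h := hK m K hN D hk hk2 hMha hM8 hR2 hP5 hℓ hpl ((le_max_left _ _).trans hM) hRM hcf hw hwb h2147 ν x x' hA0 ht0 hT c
  calc _ ≤ _ := h
    _ = _ := by ring

end

end Literature.MathematicalPhysics.QuantumFieldTheory.Balaban1983to89.B6Cor28HolderKLevelV1
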